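import Mathlib.Analysis.ODE.ExistUnique
import Mathlib.Analysis.Calculus.MeanValue
import Mathlib.Analysis.Calculus.Deriv.Prod
import Mathlib.MeasureTheory.Measure.Prod
import Mathlib.MeasureTheory.Group.Measure
import Mathlib.MeasureTheory.Measure.Haar.OfBasis
import Mathlib.Dynamics.Ergodic.MeasurePreserving
import Literature.MathematicalPhysics.KineticTheory.FouriersLaw
import HarnessLib

/-!
# Newtonian flows `q̇ = p`, `ṗ = F(q)` on `ℝ^N × ℝ^N`: uniqueness, group law, symplectic Euler shears

General (force-field–parametric) classical mechanics of `N` unit-mass degrees of freedom driven by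
a force field `F : ℝ^N → ℝ^N` (e.g. `F = -∇V` for a separable Hamiltonian `H = ½|p|² + V(q)`), on
the tree's phase space `HeatConduction.PhaseSpace N = (Fin N → ℝ) × (Fin N → ℝ)` of
`FouriersLaw.lean`. Together with `NewtonianFlowLiouville.lean` this is the intended GENERAL HOME
in `KineticTheory` of the flow/ODE infrastructure and of **Liouville's theorem** (the flow
preserves the phase volume `dq dp`, Arnold, *Mathematical Methods of Classical Mechanics* §16
Thm 1) for bounded, globally Lipschitz `F`, proved WITHOUT differentiating the flow in the initial
condition (which Mathlib does not provide): the flow map is the pointwise limit of the symplectic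
Euler scheme, a composition of shears `(q, p) ↦ (q + hp, p)`, `(q, p) ↦ (q, p + hF(q))`, each of
which preserves Lebesgue measure by Fubini.

## Relation to the rotor-chain instance already in the tree

The SAME construction exists, specialised to one force field, in
`Literature/Barriers/AtomisticToContinuum/AnticontinuumLocalizationProofs.lean` (landed
2026-08-15 for the De Roeck–Huveneers Theorem 4 reduction), namely for `F := RotorChain.force N ε γ`
(the rotor chain): `RotorChain.IsFlow` (`AnticontinuumLocalization.lean`, the three clauses of
`NewtonianFlow.IsFlow` written componentwise with `-∂_{q_x}H`), `RotorChain.driftStep` /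
`kickStep` / `eulerStep` (the shears below, same formulas), `RotorChain.measurePreserving_driftStep`
/ `_kickStep` / `_eulerStep`, `RotorChain.IsFlow.eq_orbit` / `map_add` / `map_vadd` (uniqueness,
group law, lattice equivariance) and `RotorChain.IsFlow.tendsto_iterate_eulerStep`,
`RotorChain.IsFlow.measurePreserving` (Liouville). Those are the `F := force N ε γ` instances of the
declarations of this file and of `NewtonianFlowLiouville.lean`; this file is the general version
(any bounded Lipschitz `F`, e.g. for the other chains of the topic), from which a librarian pass can
later derive the rotor-chain ones (bridging lemma
`RotorChain.IsFlow N ε γ Φ → NewtonianFlow.IsFlow (force N ε γ) Φ` to be filed on the Barriers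
side, imports flowing Barriers → KineticTheory). Nothing here is needed for
`RotorChain.GibbsStationarity`, which is discharged by `RotorChain.IsFlow.stationary`
(`AnticontinuumLocalizationStationarity.lean`).

## Contents (all proved; [folklore])

* `NewtonianFlow.vectorField F (q, p) = (p, F q)`; `NewtonianFlow.IsFlow F Φ`: `Φ : ℝ → Ω → Ω` is
  jointly continuous, `Φ_0 = id`, and `s ↦ Φ_s z` is an integral curve of `X_F` for every `z`.
* For `K`-Lipschitz `F` (Picard–Lindelöf uniqueness, `ODE_solution_unique_univ`):
  `IsFlow.eq_curve` (integral curves are flow curves), `IsFlow.unique`, the group law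
  `IsFlow.add_apply : Φ_{s+t} = Φ_s ∘ Φ_t`, `IsFlow.neg_apply_apply`/`apply_neg_apply`
  (`Φ_{-t} = Φ_t⁻¹`), and `IsFlow.apply_add_period`: a period `v` of `F` gives the symmetry
  `Φ_t(z + (v, 0)) = Φ_t z + (v, 0)`.
* A priori bounds for `‖F‖ ≤ M`: `‖p(s) - p(0)‖ ≤ M|s|`, `‖q(s) - q(0) - s p(0)‖ ≤ M s²`.
* The scheme: `drift h`, `kick F h`, `eulerStep F h = kick F h ∘ drift h` (symplectic Euler);
  `measurePreserving_drift/kick/eulerStep` (skew products of translations,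
  `MeasurePreserving.skew_product`), `continuous_eulerStep`, and the Lipschitz bound
  `dist_eulerStep_le : ‖S_h z - S_h w‖ ≤ (1 + |h|K)(1 + |h|)‖z - w‖`.
-/

noncomputable section

open MeasureTheory Filter Topology Set

namespace Literature.MathematicalPhysics.KineticTheory

open HeatConduction (PhaseSpace)

namespace NewtonianFlow


variable {N : ℕ}

/-- Newton's vector field `X_F(q, p) = (p, F(q))` on the phase space `ℝ^N × ℝ^N` (unit masses).
[folklore] -/
def vectorField (F : (Fin N → ℝ) → (Fin N → ℝ)) (z : PhaseSpace N) : PhaseSpace N :=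
  (z.2, F z.1)

/-- `Φ : ℝ → Ω → Ω` is a (the) flow of Newton's equations `q̇ = p`, `ṗ = F(q)`: jointly continuous,
`Φ_0 = id`, and every curve `s ↦ Φ_s z` is an integral curve of `X_F`. [folklore] -/
def IsFlow (F : (Fin N → ℝ) → (Fin N → ℝ)) (Φ : ℝ → PhaseSpace N → PhaseSpace N) : Prop :=
  Continuous (fun p : ℝ × PhaseSpace N => Φ p.1 p.2) ∧ (∀ z, Φ 0 z = z) ∧
    ∀ (z : PhaseSpace N) (t : ℝ), HasDerivAt (fun s => Φ s z) (vectorField F (Φ t z)) t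

/-- First component of `X_F`. [folklore] -/
@[simp] theorem vectorField_fst (F : (Fin N → ℝ) → (Fin N → ℝ)) (z : PhaseSpace N) :
    (vectorField F z).1 = z.2 := rfl

/-- Second component of `X_F`. [folklore] -/
@[simp] theorem vectorField_snd (F : (Fin N → ℝ) → (Fin N → ℝ)) (z : PhaseSpace N) :
    (vectorField F z).2 = F z.1 := rfl

/-- `X_F` is globally Lipschitz when `F` is. [folklore] -/
theorem lipschitzWith_vectorField {F : (Fin N → ℝ) → (Fin N → ℝ)} {K : NNReal}
    (hF : LipschitzWith K F) : LipschitzWith (max 1 K) (vectorField F) := by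
  have h1 : LipschitzWith 1 (fun z : PhaseSpace N => z.2) := LipschitzWith.prod_snd
  have h2 : LipschitzWith K (fun z : PhaseSpace N => F z.1) := by
    have h := hF.comp (LipschitzWith.prod_fst (α := Fin N → ℝ) (β := Fin N → ℝ))
    rw [mul_one] at h
    exact h
  change LipschitzWith (max 1 K) (fun z : PhaseSpace N => ((z.2, F z.1) : PhaseSpace N))
  exact h1.prodMk h2

variable {F : (Fin N → ℝ) → (Fin N → ℝ)} {Φ : ℝ → PhaseSpace N → PhaseSpace N}

/-- Continuity of a flow map `Φ_t`. [folklore] -/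
theorem IsFlow.continuous_apply (hΦ : IsFlow F Φ) (t : ℝ) : Continuous (Φ t) :=
  hΦ.1.comp (continuous_const.prodMk continuous_id)

/-- Continuity of a flow curve `s ↦ Φ_s z`. [folklore] -/
theorem IsFlow.continuous_curve (hΦ : IsFlow F Φ) (z : PhaseSpace N) : Continuous fun s => Φ s z :=
  hΦ.1.comp (continuous_id.prodMk continuous_const)

/-- **Uniqueness**: for Lipschitz `F`, every integral curve of `X_F` is a flow curve.
[folklore] -/
theorem IsFlow.eq_curve (hΦ : IsFlow F Φ) {K : NNReal} (hF : LipschitzWith K F)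
    {γ : ℝ → PhaseSpace N} (hγ : ∀ t, HasDerivAt γ (vectorField F (γ t)) t) {t₀ : ℝ}
    {z : PhaseSpace N} (h0 : γ t₀ = Φ t₀ z) : γ = fun s => Φ s z :=
  ODE_solution_unique_univ (v := fun _ => vectorField F) (s := fun _ => univ)
    (fun _ => (lipschitzWith_vectorField hF).lipschitzOnWith)
    (fun t => ⟨hγ t, mem_univ _⟩) (fun t => ⟨hΦ.2.2 z t, mem_univ _⟩) h0

/-- Two flows of the same Lipschitz Newtonian system coincide. [folklore] -/
theorem IsFlow.unique (hΦ : IsFlow F Φ) {Ψ : ℝ → PhaseSpace N → PhaseSpace N} (hΨ : IsFlow F Ψ)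
    {K : NNReal} (hF : LipschitzWith K F) : Ψ = Φ := by
  funext s z
  have h := hΦ.eq_curve hF (γ := fun s => Ψ s z) (fun t => hΨ.2.2 z t) (t₀ := 0)
    (by rw [hΨ.2.1, hΦ.2.1])
  exact congrFun h s

/-- **Group law** `Φ_{s+t} = Φ_s ∘ Φ_t`. [folklore] -/
theorem IsFlow.add_apply (hΦ : IsFlow F Φ) {K : NNReal} (hF : LipschitzWith K F) (s t : ℝ)
    (z : PhaseSpace N) : Φ (s + t) z = Φ s (Φ t z) := by
  have h := hΦ.eq_curve hF (γ := fun s => Φ (s + t) z)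
    (fun r => by
      have := (hΦ.2.2 z (r + t)).comp_add_const r t
      simpa using this)
    (t₀ := 0) (z := Φ t z) (by simp [hΦ.2.1])
  exact congrFun h s

/-- `Φ_{-t} ∘ Φ_t = id`. [folklore] -/
theorem IsFlow.neg_apply_apply (hΦ : IsFlow F Φ) {K : NNReal} (hF : LipschitzWith K F) (t : ℝ)
    (z : PhaseSpace N) : Φ (-t) (Φ t z) = z := by
  rw [← hΦ.add_apply hF, neg_add_cancel, hΦ.2.1]

/-- `Φ_t ∘ Φ_{-t} = id`. [folklore] -/
theorem IsFlow.apply_neg_apply (hΦ : IsFlow F Φ) {K : NNReal} (hF : LipschitzWith K F) (t : ℝ)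
    (z : PhaseSpace N) : Φ t (Φ (-t) z) = z := by
  rw [← hΦ.add_apply hF, add_neg_cancel, hΦ.2.1]

/-- **Equivariance**: a period `v` of the force (`F(q + v) = F(q)`) is a symmetry of the flow,
`Φ_t(z + (v, 0)) = Φ_t(z) + (v, 0)`. [folklore] -/
theorem IsFlow.apply_add_period (hΦ : IsFlow F Φ) {K : NNReal} (hF : LipschitzWith K F)
    {v : Fin N → ℝ} (hv : ∀ q, F (q + v) = F q) (t : ℝ) (z : PhaseSpace N) :
    Φ t (z + (v, 0)) = Φ t z + (v, 0) := by
  have h := hΦ.eq_curve hF (γ := fun s => Φ s z + (v, 0))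
    (fun r => by
      have hd := (hΦ.2.2 z r).add_const ((v, 0) : PhaseSpace N)
      have e : vectorField F (Φ r z + (v, 0)) = vectorField F (Φ r z) := by
        ext <;> simp [vectorField, hv]
      rw [e]
      exact hd)
    (t₀ := 0) (z := z + (v, 0)) (by simp [hΦ.2.1])
  exact (congrFun h t).symm

/-- The momentum component of a flow curve has derivative `F(q)`. [folklore] -/
theorem IsFlow.hasDerivAt_snd (hΦ : IsFlow F Φ) (z : PhaseSpace N) (t : ℝ) :
    HasDerivAt (fun s => (Φ s z).2) (F (Φ t z).1) t := by
  have h := ((ContinuousLinearMap.snd ℝ (Fin N → ℝ) (Fin N → ℝ)).hasFDerivAt).comp_hasDerivAt t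
    (hΦ.2.2 z t)
  exact h

/-- The position component of a flow curve has derivative `p`. [folklore] -/
theorem IsFlow.hasDerivAt_fst (hΦ : IsFlow F Φ) (z : PhaseSpace N) (t : ℝ) :
    HasDerivAt (fun s => (Φ s z).1) ((Φ t z).2) t := by
  have h := ((ContinuousLinearMap.fst ℝ (Fin N → ℝ) (Fin N → ℝ)).hasFDerivAt).comp_hasDerivAt t
    (hΦ.2.2 z t)
  exact h

/-- **A priori bound on momenta**: `‖p(s) - p(0)‖ ≤ M|s|` when `‖F‖ ≤ M`. [folklore] -/
theorem IsFlow.norm_snd_sub_le (hΦ : IsFlow F Φ) {M : ℝ} (hM : ∀ q, ‖F q‖ ≤ M) (s : ℝ)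
    (z : PhaseSpace N) : ‖(Φ s z).2 - z.2‖ ≤ M * |s| := by
  have h := Convex.norm_image_sub_le_of_norm_hasDerivWithin_le (f := fun r => (Φ r z).2)
    (f' := fun r => F (Φ r z).1) (s := uIcc 0 s) (C := M)
    (fun r _ => (hΦ.hasDerivAt_snd z r).hasDerivWithinAt) (fun r _ => hM _) (convex_uIcc 0 s)
    left_mem_uIcc right_mem_uIcc
  simpa [hΦ.2.1] using h

/-- **A priori bound on positions**: `‖q(s) - q(0) - s p(0)‖ ≤ M s²` when `‖F‖ ≤ M`. [folklore] -/
theorem IsFlow.norm_fst_sub_le (hΦ : IsFlow F Φ) {M : ℝ} (hM : ∀ q, ‖F q‖ ≤ M) (s : ℝ)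
    (z : PhaseSpace N) : ‖(Φ s z).1 - z.1 - s • z.2‖ ≤ M * s ^ 2 := by
  have hM0 : 0 ≤ M := (norm_nonneg _).trans (hM 0)
  have hd : ∀ r, HasDerivAt (fun r => (Φ r z).1 - r • z.2) ((Φ r z).2 - z.2) r := fun r => by
    have := (hΦ.hasDerivAt_fst z r).sub ((hasDerivAt_id r).smul_const z.2)
    simp only [id, one_smul] at this
    exact this
  have h := Convex.norm_image_sub_le_of_norm_hasDerivWithin_le (f := fun r => (Φ r z).1 - r • z.2)
    (f' := fun r => (Φ r z).2 - z.2) (s := uIcc 0 s) (C := M * |s|)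
    (fun r _ => (hd r).hasDerivWithinAt)
    (fun r hr => by
      refine (hΦ.norm_snd_sub_le hM r z).trans ?_
      refine mul_le_mul_of_nonneg_left ?_ hM0
      rcases le_total 0 s with hs | hs
      · rw [uIcc_of_le hs] at hr
        rw [abs_of_nonneg hr.1, abs_of_nonneg hs]; exact hr.2
      · rw [uIcc_of_ge hs] at hr
        rw [abs_of_nonpos hr.2, abs_of_nonpos hs]; linarith [hr.1])
    (convex_uIcc 0 s) left_mem_uIcc right_mem_uIcc
  have h' : ‖(Φ s z).1 - s • z.2 - z.1‖ ≤ M * |s| * |s| := by simpa [hΦ.2.1] using h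
  rw [sub_right_comm]
  calc ‖(Φ s z).1 - s • z.2 - z.1‖ ≤ M * |s| * |s| := h'
    _ = M * s ^ 2 := by rw [mul_assoc, ← sq, sq_abs]


/-! ### The symplectic Euler scheme: shears -/



/-- The drift (free streaming) map `D_h(q, p) = (q + h p, p)`. [folklore] -/
def drift (h : ℝ) (z : PhaseSpace N) : PhaseSpace N := (z.1 + h • z.2, z.2)

/-- The kick map `K_h(q, p) = (q, p + h F(q))`. [folklore] -/
def kick (F : (Fin N → ℝ) → (Fin N → ℝ)) (h : ℝ) (z : PhaseSpace N) : PhaseSpace N :=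
  (z.1, z.2 + h • F z.1)

/-- One step of the symplectic Euler scheme, `S_h = K_h ∘ D_h`:
`S_h(q, p) = (q + hp, p + hF(q + hp))`. [folklore] -/
def eulerStep (F : (Fin N → ℝ) → (Fin N → ℝ)) (h : ℝ) (z : PhaseSpace N) : PhaseSpace N :=
  kick F h (drift h z)

/-- `S_h(q, p) = (q + hp, p + hF(q + hp))`. [folklore] -/
theorem eulerStep_apply (F : (Fin N → ℝ) → (Fin N → ℝ)) (h : ℝ) (z : PhaseSpace N) :
    eulerStep F h z = (z.1 + h • z.2, z.2 + h • F (z.1 + h • z.2)) := rfl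

/-- The drift is a shear over the momenta, hence preserves Lebesgue measure (Fubini and
translation invariance). [folklore] -/
theorem measurePreserving_drift (h : ℝ) :
    MeasurePreserving (drift (N := N) h) volume volume := by
  have hskew : MeasurePreserving
      (fun p : (Fin N → ℝ) × (Fin N → ℝ) => (p.1, p.2 + h • p.1))
      ((volume : Measure (Fin N → ℝ)).prod volume) ((volume : Measure (Fin N → ℝ)).prod volume) :=
    (MeasurePreserving.id _).skew_product (g := fun p q => q + h • p)
      (measurable_snd.add (measurable_fst.const_smul h))
      (ae_of_all _ fun p => (measurePreserving_add_right volume (h • p)).map_eq)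
  have e : (drift (N := N) h) = Prod.swap ∘
      (fun p : (Fin N → ℝ) × (Fin N → ℝ) => (p.1, p.2 + h • p.1)) ∘ Prod.swap := by
    funext z; rfl
  rw [show (volume : Measure (PhaseSpace N)) = (volume : Measure (Fin N → ℝ)).prod volume from rfl, e]
  exact Measure.measurePreserving_swap.comp (hskew.comp Measure.measurePreserving_swap)

/-- The kick is a shear over the positions, hence preserves Lebesgue measure. [folklore] -/
theorem measurePreserving_kick {F : (Fin N → ℝ) → (Fin N → ℝ)} (hF : Measurable F) (h : ℝ) :
    MeasurePreserving (kick (N := N) F h) volume volume := by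
  rw [show (volume : Measure (PhaseSpace N)) = (volume : Measure (Fin N → ℝ)).prod volume from rfl]
  exact (MeasurePreserving.id _).skew_product (g := fun q p => p + h • F q)
    (measurable_snd.add ((hF.comp measurable_fst).const_smul h))
    (ae_of_all _ fun q => (measurePreserving_add_right volume (h • F q)).map_eq)

/-- The symplectic Euler step preserves Lebesgue measure. [folklore] -/
theorem measurePreserving_eulerStep {F : (Fin N → ℝ) → (Fin N → ℝ)} (hF : Measurable F) (h : ℝ) :
    MeasurePreserving (eulerStep (N := N) F h) volume volume :=
  (measurePreserving_kick hF h).comp (measurePreserving_drift h)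

/-- Continuity of the Euler step. [folklore] -/
theorem continuous_eulerStep {F : (Fin N → ℝ) → (Fin N → ℝ)} (hF : Continuous F) (h : ℝ) :
    Continuous (eulerStep (N := N) F h) := by
  unfold eulerStep kick drift
  fun_prop

/-- Lipschitz bound for the Euler step: `Lip(S_h) ≤ (1 + |h|K)(1 + |h|)`. [folklore] -/
theorem dist_eulerStep_le {F : (Fin N → ℝ) → (Fin N → ℝ)} {K : NNReal} (hF : LipschitzWith K F)
    (h : ℝ) (z w : PhaseSpace N) :
    ‖eulerStep F h z - eulerStep F h w‖ ≤ (1 + |h| * K) * (1 + |h|) * ‖z - w‖ := by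
  have hq : ‖z.1 - w.1‖ ≤ ‖z - w‖ := norm_fst_le (z - w)
  have hp : ‖z.2 - w.2‖ ≤ ‖z - w‖ := norm_snd_le (z - w)
  have hd : ‖(z.1 + h • z.2) - (w.1 + h • w.2)‖ ≤ (1 + |h|) * ‖z - w‖ := by
    calc ‖(z.1 + h • z.2) - (w.1 + h • w.2)‖ = ‖(z.1 - w.1) + h • (z.2 - w.2)‖ := by
          congr 1; rw [smul_sub]; abel
      _ ≤ ‖z.1 - w.1‖ + ‖h • (z.2 - w.2)‖ := norm_add_le _ _
      _ ≤ ‖z - w‖ + |h| * ‖z - w‖ := by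
          rw [norm_smul, Real.norm_eq_abs]; gcongr
      _ = (1 + |h|) * ‖z - w‖ := by ring
  have hK : ‖F (z.1 + h • z.2) - F (w.1 + h • w.2)‖ ≤ K * ((1 + |h|) * ‖z - w‖) :=
    (hF.norm_sub_le _ _).trans (mul_le_mul_of_nonneg_left hd K.2)
  rw [eulerStep_apply, eulerStep_apply, Prod.norm_def]
  refine max_le ?_ ?_
  · refine hd.trans ?_
    have : 0 ≤ |h| * K * ((1 + |h|) * ‖z - w‖) := by positivity
    nlinarith
  · calc ‖z.2 + h • F (z.1 + h • z.2) - (w.2 + h • F (w.1 + h • w.2))‖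
        = ‖(z.2 - w.2) + h • (F (z.1 + h • z.2) - F (w.1 + h • w.2))‖ := by
          congr 1; rw [smul_sub]; abel
      _ ≤ ‖z.2 - w.2‖ + ‖h • (F (z.1 + h • z.2) - F (w.1 + h • w.2))‖ := norm_add_le _ _
      _ ≤ ‖z - w‖ + |h| * (K * ((1 + |h|) * ‖z - w‖)) := by
          rw [norm_smul, Real.norm_eq_abs]; gcongr
      _ ≤ (1 + |h| * K) * (1 + |h|) * ‖z - w‖ := by
          have : 0 ≤ |h| * ‖z - w‖ := by positivity
          nlinarith

end NewtonianFlow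

end Literature.MathematicalPhysics.KineticTheory

end
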